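import Literature.Computability.Cryptography.HallgrenClassGroupXgcdFP
import Literature.Computability.Cryptography.HallgrenClassGroupFormComposition
import Literature.Computability.Complexity.CodeFPLists
import HarnessLib

/-!
# Hallgren 2005 / class numbers under GRH — programming step P2: the raw composition of forms in
# the typed polynomial-time algebra `CodeFP`

Topic `Literature/Computability/Cryptography`; proof companion of `HallgrenClassGroup.lean`
(named fact `Hallgren2005_classNumber_qsolvable_of_GRH`). Definitions and theorems; no named fact.
Sequel of `HallgrenClassGroupXgcdFP.lean` (`Int.gcd`, `Int.gcdA`, `Int.gcdB` on codes). The lattice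
composition of `HallgrenClassGroupComposition.lean` / `HallgrenClassGroupFormComposition.lean`
(`rawCompose D f g = (A, 2K − D, (K² − DK − m(D))/A)`, `A = compA`, `K = compK` from the Bézout fold
`gcdVec` of the four product vectors and the gcd `axisGcd` of their axis parts) is a STRAIGHT-LINE
integer program once the four-element folds are unfolded (`gcdVec_prodVecs`, `axisGcd_eq_gcd`); this
file types it:

* the code of forms `formE f = ⟨dp a, ⟨dp b, dp c⟩⟩` and its field maps;
* `bez v w = gcdA(v₂, w₂) v + gcdB(v₂, w₂) w` (`bezC`), `gcdVec_prodVecs`, `axisGcd_eq_gcd`;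
* **`rawComposeC : CodeFP (pairE intE (pairE formE formE)) formE (fun p => rawCompose p.1 p.2.1 p.2.2)`**,
  `kOfC`, `mOfC`.

## References

* D. A. Cox, *Primes of the form x² + ny²*, 2nd ed. (2013), §3.A [Cox2013].
* S. Arora, B. Barak, *Computational Complexity: A Modern Approach*, CUP 2009, §1.3 [AroraBarak2009].
-/

namespace Literature.Computability.Cryptography.Hallgren2005

namespace ClFP

open Literature.Computability.Complexity Literature.Computability.Complexity.CodeFP
open Literature.NumberTheory.QuadraticFields.Quadratic (BinQF)
open FormComposition Composition LatticeHNF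

/-! ### Codes of forms and vectors -/

/-- The code of a form: `⟨dp a, ⟨dp b, dp c⟩⟩`. [folklore] -/
def formE : BinQF → List Bool := fun f => pairE intE (pairE intE intE) (f.a, f.b, f.c)

/-- The code of an integer vector. [folklore] -/
abbrev vecE : ℤ × ℤ → List Bool := pairE intE intE

/-- `formE` is injective. [folklore] -/
theorem formE_injective : Function.Injective formE := by
  intro f g h
  have := pairE_injective intE_injective (pairE_injective intE_injective intE_injective) h
  obtain ⟨a, b, c⟩ := f
  obtain ⟨a', b', c'⟩ := g
  simp only [Prod.mk.injEq] at this
  obtain ⟨rfl, rfl, rfl⟩ := this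
  rfl

/-- The fields of a form. [folklore] -/
theorem fieldsC : CodeFP formE (pairE intE (pairE intE intE)) (fun f => (f.a, f.b, f.c)) :=
  transparent fun _ => rfl

/-- Building a form from its fields. [folklore] -/
theorem mkFormC : CodeFP (pairE intE (pairE intE intE)) formE (fun p => (⟨p.1, p.2.1, p.2.2⟩ : BinQF)) :=
  transparent fun _ => rfl

/-- `f ↦ a`. [folklore] -/
theorem aC : CodeFP formE intE BinQF.a := fieldsC.fst'
/-- `f ↦ b`. [folklore] -/
theorem bC : CodeFP formE intE BinQF.b := fieldsC.snd'.fst'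
/-- `f ↦ c`. [folklore] -/
theorem cC : CodeFP formE intE BinQF.c := fieldsC.snd'.snd'

/-- `Int.gcd` as an integer, on codes. [folklore] -/
theorem intGcdC : CodeFP (pairE intE intE) intE (fun p => (Int.gcd p.1 p.2 : ℤ)) :=
  intOfNat.comp intGcdABC.fst'

/-- `D ↦ m(D) = (D − D²)/4`. [folklore] -/
theorem mOfC : CodeFP intE intE mOf := by
  have hid : CodeFP intE intE (fun D => D) := CodeFP.id intE
  have hsq := intMul.comp (hid.pair hid)
  have h4 : CodeFP intE intE (fun _ => (4 : ℤ)) := const intE (4 : ℤ)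
  have h := intEDiv.comp ((intSub.comp (hid.pair hsq)).pair h4)
  exact h.congr fun D => by simp [mOf, sq]

/-- `(D, f) ↦ k(f) = (b + D)/2`. [folklore] -/
theorem kOfC : CodeFP (pairE intE formE) intE (fun p => kOf p.1 p.2) := by
  have hD : CodeFP (pairE intE formE) intE (fun p => p.1) := fst intE formE
  have hb := bC.comp (snd intE formE)
  have h2 : CodeFP (pairE intE formE) intE (fun _ => (2 : ℤ)) := const _ (2 : ℤ)
  have h := intEDiv.comp ((intAdd.comp (hb.pair hD)).pair h2)
  exact h.congr fun p => by simp [kOf]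

/-! ### The Bézout combination and the unfolded folds -/

/-- `bez v w = gcdA(v₂, w₂) • v + gcdB(v₂, w₂) • w` — one step of `gcdVec`. [folklore] -/
def bez (v w : ℤ × ℤ) : ℤ × ℤ :=
  (Int.gcdA v.2 w.2 * v.1 + Int.gcdB v.2 w.2 * w.1, Int.gcdA v.2 w.2 * v.2 + Int.gcdB v.2 w.2 * w.2)

/-- `gcdVec (v :: vs) = bez v (gcdVec vs)`. [folklore] -/
theorem gcdVec_cons_eq_bez (v : ℤ × ℤ) (vs : List (ℤ × ℤ)) : gcdVec (v :: vs) = bez v (gcdVec vs) := by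
  rw [gcdVec, bez]; ext <;> simp

/-- **The Bézout fold of the four product vectors, unfolded.** [folklore] -/
theorem gcdVec_prodVecs (t m a₁ k₁ a₂ k₂ : ℤ) :
    gcdVec (prodVecs t m a₁ k₁ a₂ k₂) =
      bez (a₁ * a₂, 0) (bez (-(a₁ * k₂), a₁) (bez (-(a₂ * k₁), a₂) (bez (m + k₁ * k₂, t - k₁ - k₂) (0, 0)))) := by
  rw [prodVecs, gcdVec_cons_eq_bez, gcdVec_cons_eq_bez, gcdVec_cons_eq_bez, gcdVec_cons_eq_bez, gcdVec]

/-- The axis part of a vector along `w`. [folklore] -/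
def axisOf (w v : ℤ × ℤ) : ℤ × ℤ := (v.1 - v.2 / w.2 * w.1, v.2 - v.2 / w.2 * w.2)

/-- `axisPart` in terms of `axisOf`. [folklore] -/
theorem axisPart_eq_map (L : List (ℤ × ℤ)) : axisPart L = L.map (axisOf (gcdVec L)) := by
  rw [axisPart]
  refine List.map_congr_left fun v _ => ?_
  rw [axisOf]; ext <;> simp

/-- **`axisGcd` of a four-element list is an iterated gcd of first coordinates of axis parts.**
[folklore] -/
theorem axisGcd_eq_gcd (v₁ v₂ v₃ v₄ : ℤ × ℤ) :
    axisGcd [v₁, v₂, v₃, v₄] =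
      (Int.gcd (axisOf (gcdVec [v₁, v₂, v₃, v₄]) v₁).1
        (Int.gcd (axisOf (gcdVec [v₁, v₂, v₃, v₄]) v₂).1
          (Int.gcd (axisOf (gcdVec [v₁, v₂, v₃, v₄]) v₃).1
            (Int.gcd (axisOf (gcdVec [v₁, v₂, v₃, v₄]) v₄).1 0 : ℤ) : ℤ) : ℤ) : ℤ) := by
  rw [axisGcd, axisPart_eq_map]
  simp only [List.map_cons, List.map_nil, gcdVec_cons_snd, Prod.snd_swap]
  rfl

/-- `bez` on codes. [folklore] -/
theorem bezC : CodeFP (pairE vecE vecE) vecE (fun p => bez p.1 p.2) := by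
  have hv : CodeFP (pairE vecE vecE) vecE (fun p => p.1) := fst vecE vecE
  have hw : CodeFP (pairE vecE vecE) vecE (fun p => p.2) := snd vecE vecE
  have hv1 : CodeFP (pairE vecE vecE) intE (fun p => p.1.1) := hv.fst'
  have hv2 : CodeFP (pairE vecE vecE) intE (fun p => p.1.2) := hv.snd'
  have hw1 : CodeFP (pairE vecE vecE) intE (fun p => p.2.1) := hw.fst'
  have hw2 : CodeFP (pairE vecE vecE) intE (fun p => p.2.2) := hw.snd'
  have hg := intGcdABC.comp (hv2.pair hw2)
  have hA := hg.snd'.fst'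
  have hB := hg.snd'.snd'
  have h1 := intAdd.comp ((intMul.comp (hA.pair hv1)).pair (intMul.comp (hB.pair hw1)))
  have h2 := intAdd.comp ((intMul.comp (hA.pair hv2)).pair (intMul.comp (hB.pair hw2)))
  exact (h1.pair h2).congr fun p => rfl

/-- `axisOf` on codes. [folklore] -/
theorem axisOfC : CodeFP (pairE vecE vecE) vecE (fun p => axisOf p.1 p.2) := by
  have hw : CodeFP (pairE vecE vecE) vecE (fun p => p.1) := fst vecE vecE
  have hv : CodeFP (pairE vecE vecE) vecE (fun p => p.2) := snd vecE vecE
  have hw1 : CodeFP (pairE vecE vecE) intE (fun p => p.1.1) := hw.fst'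
  have hw2 : CodeFP (pairE vecE vecE) intE (fun p => p.1.2) := hw.snd'
  have hv1 : CodeFP (pairE vecE vecE) intE (fun p => p.2.1) := hv.fst'
  have hv2 : CodeFP (pairE vecE vecE) intE (fun p => p.2.2) := hv.snd'
  have hq := intEDiv.comp (hv2.pair hw2)
  have h1 := intSub.comp (hv1.pair (intMul.comp (hq.pair hw1)))
  have h2 := intSub.comp (hv2.pair (intMul.comp (hq.pair hw2)))
  exact (h1.pair h2).congr fun p => rfl

/-! ### The raw composition -/

/-- The parameters `(t, m, a₁, k₁, a₂, k₂)` of an input `(D, f, g)`. [folklore] -/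
def params (p : ℤ × BinQF × BinQF) : ℤ × ℤ × ℤ × ℤ × ℤ × ℤ :=
  (p.1, mOf p.1, p.2.1.a, kOf p.1 p.2.1, p.2.2.a, kOf p.1 p.2.2)

/-- The code of the parameters. [folklore] -/
abbrev parE : ℤ × ℤ × ℤ × ℤ × ℤ × ℤ → List Bool := pairE intE (pairE intE (pairE intE (pairE intE (pairE intE intE))))

/-- `params` on codes. [folklore] -/
theorem paramsC : CodeFP (pairE intE (pairE formE formE)) parE params := by
  have hD : CodeFP (pairE intE (pairE formE formE)) intE (fun p => p.1) := fst intE (pairE formE formE)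
  have hfg : CodeFP (pairE intE (pairE formE formE)) (pairE formE formE) (fun p => p.2) := snd intE (pairE formE formE)
  have hf : CodeFP (pairE intE (pairE formE formE)) formE (fun p => p.2.1) := hfg.fst'
  have hg : CodeFP (pairE intE (pairE formE formE)) formE (fun p => p.2.2) := hfg.snd'
  have hm := mOfC.comp hD
  have ha₁ := aC.comp hf
  have ha₂ := aC.comp hg
  have hk₁ := kOfC.comp (hD.pair hf)
  have hk₂ := kOfC.comp (hD.pair hg)
  exact (hD.pair (hm.pair (ha₁.pair (hk₁.pair (ha₂.pair hk₂))))).congr fun p => rfl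

/-- The four product vectors from the parameters. [folklore] -/
def pvecs (q : ℤ × ℤ × ℤ × ℤ × ℤ × ℤ) : (ℤ × ℤ) × (ℤ × ℤ) × (ℤ × ℤ) × (ℤ × ℤ) :=
  match q with
  | (t, m, a₁, k₁, a₂, k₂) => ((a₁ * a₂, 0), (-(a₁ * k₂), a₁), (-(a₂ * k₁), a₂), (m + k₁ * k₂, t - k₁ - k₂))

/-- `pvecs` on codes. [folklore] -/
theorem pvecsC : CodeFP parE (pairE vecE (pairE vecE (pairE vecE vecE))) pvecs := by
  have ht : CodeFP parE intE (fun q => q.1) := fst intE _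
  have hr1 : CodeFP parE (pairE intE (pairE intE (pairE intE (pairE intE intE)))) (fun q => q.2) := snd intE _
  have hm : CodeFP parE intE (fun q => q.2.1) := hr1.fst'
  have ha₁ : CodeFP parE intE (fun q => q.2.2.1) := hr1.snd'.fst'
  have hk₁ : CodeFP parE intE (fun q => q.2.2.2.1) := hr1.snd'.snd'.fst'
  have ha₂ : CodeFP parE intE (fun q => q.2.2.2.2.1) := hr1.snd'.snd'.snd'.fst'
  have hk₂ : CodeFP parE intE (fun q => q.2.2.2.2.2) := hr1.snd'.snd'.snd'.snd'
  have h0 : CodeFP parE intE (fun _ => (0 : ℤ)) := const parE (0 : ℤ)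
  have hv1 := (intMul.comp (ha₁.pair ha₂)).pair h0
  have hv2 := (intNeg.comp (intMul.comp (ha₁.pair hk₂))).pair ha₁
  have hv3 := (intNeg.comp (intMul.comp (ha₂.pair hk₁))).pair ha₂
  have hv4 := (intAdd.comp (hm.pair (intMul.comp (hk₁.pair hk₂)))).pair (intSub.comp ((intSub.comp (ht.pair hk₁)).pair hk₂))
  refine (hv1.pair (hv2.pair (hv3.pair hv4))).congr fun q => ?_
  obtain ⟨t, m, a₁, k₁, a₂, k₂⟩ := q
  rfl

/-- The Bézout vector `w` of the four product vectors. [folklore] -/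
def wOf (v : (ℤ × ℤ) × (ℤ × ℤ) × (ℤ × ℤ) × (ℤ × ℤ)) : ℤ × ℤ :=
  bez v.1 (bez v.2.1 (bez v.2.2.1 (bez v.2.2.2 (0, 0))))

/-- `wOf` on codes. [folklore] -/
theorem wOfC : CodeFP (pairE vecE (pairE vecE (pairE vecE vecE))) vecE wOf := by
  have hv1 : CodeFP (pairE vecE (pairE vecE (pairE vecE vecE))) vecE (fun v => v.1) := fst vecE _
  have hr : CodeFP (pairE vecE (pairE vecE (pairE vecE vecE))) (pairE vecE (pairE vecE vecE)) (fun v => v.2) := snd vecE _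
  have hv2 : CodeFP (pairE vecE (pairE vecE (pairE vecE vecE))) vecE (fun v => v.2.1) := hr.fst'
  have hv3 : CodeFP (pairE vecE (pairE vecE (pairE vecE vecE))) vecE (fun v => v.2.2.1) := hr.snd'.fst'
  have hv4 : CodeFP (pairE vecE (pairE vecE (pairE vecE vecE))) vecE (fun v => v.2.2.2) := hr.snd'.snd'
  have h0 : CodeFP (pairE vecE (pairE vecE (pairE vecE vecE))) vecE (fun _ => ((0 : ℤ), (0 : ℤ))) := const _ ((0 : ℤ), (0 : ℤ))
  have h4 := bezC.comp (hv4.pair h0)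
  have h3 := bezC.comp (hv3.pair h4)
  have h2 := bezC.comp (hv2.pair h3)
  exact (bezC.comp (hv1.pair h2)).congr fun v => rfl

/-- The axis gcd `g'` from `w` and the four vectors. [folklore] -/
def gOf (p : (ℤ × ℤ) × ((ℤ × ℤ) × (ℤ × ℤ) × (ℤ × ℤ) × (ℤ × ℤ))) : ℤ :=
  (Int.gcd (axisOf p.1 p.2.1).1 (Int.gcd (axisOf p.1 p.2.2.1).1
    (Int.gcd (axisOf p.1 p.2.2.2.1).1 (Int.gcd (axisOf p.1 p.2.2.2.2).1 0 : ℤ) : ℤ) : ℤ) : ℤ)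

/-- `gOf` on codes. [folklore] -/
theorem gOfC : CodeFP (pairE vecE (pairE vecE (pairE vecE (pairE vecE vecE)))) intE gOf := by
  have hw : CodeFP (pairE vecE (pairE vecE (pairE vecE (pairE vecE vecE)))) vecE (fun p => p.1) := fst vecE _
  have hr : CodeFP (pairE vecE (pairE vecE (pairE vecE (pairE vecE vecE)))) (pairE vecE (pairE vecE (pairE vecE vecE)))
      (fun p => p.2) := snd vecE _
  have hv1 : CodeFP (pairE vecE (pairE vecE (pairE vecE (pairE vecE vecE)))) vecE (fun p => p.2.1) := hr.fst'
  have hv2 : CodeFP (pairE vecE (pairE vecE (pairE vecE (pairE vecE vecE)))) vecE (fun p => p.2.2.1) := hr.snd'.fst'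
  have hv3 : CodeFP (pairE vecE (pairE vecE (pairE vecE (pairE vecE vecE)))) vecE (fun p => p.2.2.2.1) := hr.snd'.snd'.fst'
  have hv4 : CodeFP (pairE vecE (pairE vecE (pairE vecE (pairE vecE vecE)))) vecE (fun p => p.2.2.2.2) := hr.snd'.snd'.snd'
  have hu1 := (axisOfC.comp (hw.pair hv1)).fst'
  have hu2 := (axisOfC.comp (hw.pair hv2)).fst'
  have hu3 := (axisOfC.comp (hw.pair hv3)).fst'
  have hu4 := (axisOfC.comp (hw.pair hv4)).fst'
  have h0 : CodeFP (pairE vecE (pairE vecE (pairE vecE (pairE vecE vecE)))) intE (fun _ => (0 : ℤ)) := const _ (0 : ℤ)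
  have g4 := intGcdC.comp (hu4.pair h0)
  have g3 := intGcdC.comp (hu3.pair g4)
  have g2 := intGcdC.comp (hu2.pair g3)
  exact (intGcdC.comp (hu1.pair g2)).congr fun p => rfl

/-- **The raw composite from the parameters** (closed form). [cite: Cox2013, §3.A (composition)] -/
def rawOfParams (q : ℤ × ℤ × ℤ × ℤ × ℤ × ℤ) : BinQF :=
  let w := wOf (pvecs q)
  let g := gOf (w, pvecs q)
  let A := g / w.2
  let K := -(w.1 / w.2)
  ⟨A, 2 * K - q.1, (K ^ 2 - q.1 * K - q.2.1) / A⟩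

/-- `rawCompose` is `rawOfParams ∘ params`. [folklore] -/
theorem rawCompose_eq (D : ℤ) (f g : BinQF) : rawCompose D f g = rawOfParams (params (D, f, g)) := by
  have hw : gcdVec (prodVecs D (mOf D) f.a (kOf D f) g.a (kOf D g)) = wOf (pvecs (params (D, f, g))) := by
    rw [gcdVec_prodVecs]; rfl
  have hg : axisGcd (prodVecs D (mOf D) f.a (kOf D f) g.a (kOf D g)) =
      gOf (wOf (pvecs (params (D, f, g))), pvecs (params (D, f, g))) := by
    rw [prodVecs, axisGcd_eq_gcd, ← prodVecs, hw]; rfl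
  simp only [rawCompose, compA, compK, compX, compD, hw, hg, rawOfParams]
  rfl

/-- `rawOfParams` on codes. [folklore] -/
theorem rawOfParamsC : CodeFP parE formE rawOfParams := by
  have hv : CodeFP parE (pairE vecE (pairE vecE (pairE vecE vecE))) pvecs := pvecsC
  have hw := wOfC.comp hv
  have hg := gOfC.comp (hw.pair hv)
  have hA := intEDiv.comp (hg.pair hw.snd')
  have hK := intNeg.comp (intEDiv.comp (hw.fst'.pair hw.snd'))
  have ht : CodeFP parE intE (fun q => q.1) := fst intE _
  have hm : CodeFP parE intE (fun q => q.2.1) := (snd intE (pairE intE (pairE intE (pairE intE (pairE intE intE))))).fst'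
  have h2 : CodeFP parE intE (fun _ => (2 : ℤ)) := const parE (2 : ℤ)
  have hB := intSub.comp ((intMul.comp (h2.pair hK)).pair ht)
  have hC := intEDiv.comp ((intSub.comp ((intSub.comp ((intMul.comp (hK.pair hK)).pair (intMul.comp (ht.pair hK)))).pair hm)).pair hA)
  refine (mkFormC.comp (hA.pair (hB.pair hC))).congr fun q => ?_
  simp only [rawOfParams, sq]

/-- **The raw composition `(D, f, g) ↦ rawCompose D f g` is computed on codes.**
[cite: Cox2013, §3.A (composition); AroraBarak2009, §1.3] -/
theorem rawComposeC : CodeFP (pairE intE (pairE formE formE)) formE (fun p => rawCompose p.1 p.2.1 p.2.2) :=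
  (rawOfParamsC.comp paramsC).congr fun p => (rawCompose_eq p.1 p.2.1 p.2.2).symm

end ClFP

end Literature.Computability.Cryptography.Hallgren2005
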